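import Summits.QuantumAdvantage.QuantumAdvantage.Theorems.CubicForrelationNearExactIsExactTwelvePartnerRadical
import Summits.QuantumAdvantage.QuantumAdvantage.Theorems.CubicForrelationNearExactIsExactCubicFormR4Cells
import Summits.QuantumAdvantage.QuantumAdvantage.Theorems.CubicForrelationNearExactIsExactCubicFormR4QfPolar

/-!
# Crux `CubicForrelation.NearExactIsExact` (stmt-QuantumAdvantage-14043) — E1280-even, R4 branch, descendant `T` (`HL 1`): the
  RADICAL VECTOR `u + y e_{y_a}` for a free `z`-vector `u`

Certificate seat `b2b-cforr-cert` (gen 43).  HONEST FRAMING: kernel-checked linear algebra over `𝔽₂` (standard axioms) — the last step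
of descendant `t̄₇ = T` (E1280-HANDPROOFS §2.2–2.3 "radical leaves", here WITHOUT coordinate changes: the gauge term is absorbed by an
`e_{y_a}`-component, as in …CubicFormR4QfRadical for `x₁q₄`).  In the adapted R4 frame (`y_a = e₀`, `v_t = e_{1+t}`, `z_j = e_{5+j}`;
`d(y_a,·,·) = v₀v₁ + v₂v₃` by `hF`):
* `tq1_radical` (form level): if for a nonzero `u ∈ 𝔽₂⁷` (read in the `z`-block) and a bit `y` the combination `Σ_σ u_σ d(z_σ,·,·)`
  vanishes on `z × z` and on `v × z`, and `Σ_σ u_σ d(z_σ,v_a,v_b) + y·d(y_a,v_a,v_b) = 0`, then `U = u + y e_{y_a} ≠ 0` has `ι_U d = 0`,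
  contradicting the partner equations (`tpr_radical_obstruction`).
* `tq1_radical_step` (function level): for cubic `κ` with cubic form `d` (`hd`), if `d` vanishes on `z_σ × z × z` for the free `σ ≥ 3`,
  `û ∈ 𝔽₂⁷` is supported on the free coordinates, the second differences of every cell `f_v = κ(0,v,·)` along `(û, e_k)` vanish at `0`,
  and `f_v(û) = f_v(0)` for the ten cells `v ∈ Z₁₀`, then `False`: the first hypothesis gives `Σ u_σ d(z_σ, v_t, z_k) = 0`
  (expansion `tcf_third_sum1`), the second makes `v ↦ f_v(û) ⊕ f_v(0)` a function with constant second differences vanishing on `Z₁₀`,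
  whose polar form is `y·(v₀v₁ + v₂v₃)` (`tq4_polar_table`), i.e. `Σ u_σ d(z_σ,v_a,v_b) = y·d(y_a,v_a,v_b)`; then `tq1_radical`.
Nothing about `θ₁₂`; NOT summit progress.

References: this seat lineage (g39 HANDPROOFS §0.2/§2.2–2.3, g43 LEAN-GEN43).  Axioms: the standard three.
-/

set_option linter.dupNamespace false -- D-0017: single-problem summit ⇒ `QuantumAdvantage.QuantumAdvantage` by design

namespace Summit.QuantumAdvantage.QuantumAdvantage.Theorems.CubicForrelation.NearExactIsExact

open Finset
open Literature.Computability.QuantumComplexity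
open Literature.Computability.QuantumComplexity.BuzetChailloux (bxor zeroVec bxor_comm bxor_self bxor_zeroVec zeroVec_bxor
  bxor_bxor_cancel_left)

/-- **The radical vector of descendant `T` (form level).**  See the module docstring. [this work] -/
theorem tq1_radical (c d : Fin (5 + 7) → Fin (5 + 7) → Fin (5 + 7) → ZMod 2)
    (hdc : ∀ φ j k, d j φ k = d φ j k) (hds : ∀ φ j k, d φ k j = d φ j k)
    (hpair : ∀ p φ, (∑ j, ∑ k, (if j < k then c p j k * d φ j k else 0)) = if p = φ then 1 else 0)
    (hF : ∀ j k, d (Fin.castAdd 7 (0 : Fin 5)) j k =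
      (if (j = Fin.castAdd 7 (1 : Fin 5) ∧ k = Fin.castAdd 7 (2 : Fin 5)) ∨ (j = Fin.castAdd 7 (2 : Fin 5) ∧ k = Fin.castAdd 7 (1 : Fin 5)) then 1 else 0) +
      (if (j = Fin.castAdd 7 (3 : Fin 5) ∧ k = Fin.castAdd 7 (4 : Fin 5)) ∨ (j = Fin.castAdd 7 (4 : Fin 5) ∧ k = Fin.castAdd 7 (3 : Fin 5)) then 1 else 0))
    (uz : Fin 7 → ZMod 2) (y : ZMod 2) (huz : uz ≠ 0)
    (hzz : ∀ j k : Fin 7, (∑ σ, uz σ * d (Fin.natAdd 5 σ) (Fin.natAdd 5 j) (Fin.natAdd 5 k)) = 0)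
    (hvz : ∀ (t : Fin 4) (k : Fin 7), (∑ σ, uz σ * d (Fin.natAdd 5 σ) (Fin.castAdd 7 t.succ) (Fin.natAdd 5 k)) = 0)
    (hvv : ∀ a b : Fin 4, (∑ σ, uz σ * d (Fin.natAdd 5 σ) (Fin.castAdd 7 a.succ) (Fin.castAdd 7 b.succ)) +
        y * d (Fin.castAdd 7 (0 : Fin 5)) (Fin.castAdd 7 a.succ) (Fin.castAdd 7 b.succ) = 0) : False := by
  -- the `y_a`-slice vanishes as soon as one argument is a `z`-coordinate or `y_a` itself
  have hne : ∀ (i : Fin 5) (k : Fin 7), (Fin.natAdd 5 k : Fin (5 + 7)) ≠ Fin.castAdd 7 i := by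
    intro i k e
    have := congrArg Fin.val e
    simp only [Fin.val_natAdd, Fin.val_castAdd] at this
    omega
  have hFz : ∀ (j : Fin (5 + 7)) (k : Fin 7), d (Fin.castAdd 7 (0 : Fin 5)) j (Fin.natAdd 5 k) = 0 := by
    intro j k
    rw [hF, if_neg (by rintro (⟨-, h⟩ | ⟨-, h⟩) <;> exact hne _ _ h), if_neg (by rintro (⟨-, h⟩ | ⟨-, h⟩) <;> exact hne _ _ h),
      add_zero]
  have hFz' : ∀ (j : Fin (5 + 7)) (k : Fin 7), d (Fin.castAdd 7 (0 : Fin 5)) (Fin.natAdd 5 k) j = 0 := by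
    intro j k; rw [hds]; exact hFz j k
  have hFa : ∀ j : Fin (5 + 7), d (Fin.castAdd 7 (0 : Fin 5)) (Fin.castAdd 7 (0 : Fin 5)) j = 0 := by
    intro j
    rw [hF, if_neg (by rintro (⟨h, -⟩ | ⟨h, -⟩) <;> exact absurd (congrArg Fin.val h) (by decide)),
      if_neg (by rintro (⟨h, -⟩ | ⟨h, -⟩) <;> exact absurd (congrArg Fin.val h) (by decide)), add_zero]
  have hFa' : ∀ j : Fin (5 + 7), d (Fin.castAdd 7 (0 : Fin 5)) j (Fin.castAdd 7 (0 : Fin 5)) = 0 := by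
    intro j; rw [hds]; exact hFa j
  -- `z_m`-slices with a `y_a` argument vanish (symmetry + `hF`)
  have hzy : ∀ (m : Fin 7) (j : Fin (5 + 7)), d (Fin.natAdd 5 m) (Fin.castAdd 7 (0 : Fin 5)) j = 0 := by
    intro m j; rw [hdc]; exact hFz' j m
  have hzy' : ∀ (m : Fin 7) (j : Fin (5 + 7)), d (Fin.natAdd 5 m) j (Fin.castAdd 7 (0 : Fin 5)) = 0 := by
    intro m j; rw [hds]; exact hzy m j
  -- the combination `Σ u_σ d(z_σ,j,k) + y·d(y_a,j,k)` vanishes for all `j, k`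
  have hcomb : ∀ j k : Fin (5 + 7), (∑ σ, uz σ * d (Fin.natAdd 5 σ) j k) + y * d (Fin.castAdd 7 (0 : Fin 5)) j k = 0 := by
    intro j k
    refine Fin.addCases (fun a => ?_) (fun j' => ?_) j
    · refine Fin.addCases (fun b => ?_) (fun k' => ?_) k
      · refine Fin.cases ?_ (fun t => ?_) a
        · simp only [hzy, mul_zero, sum_const_zero, hFa, zero_add]
        · refine Fin.cases ?_ (fun s => ?_) b
          · simp only [hzy', mul_zero, sum_const_zero, hFa', zero_add]
          · exact hvv t s
      · refine Fin.cases ?_ (fun t => ?_) a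
        · simp only [hzy, mul_zero, sum_const_zero, hFa, zero_add]
        · rw [hvz, hFz]; ring
    · refine Fin.addCases (fun b => ?_) (fun k' => ?_) k
      · refine Fin.cases ?_ (fun s => ?_) b
        · simp only [hzy', mul_zero, sum_const_zero, hFa', zero_add]
        · have e1 := hvz s j'
          rw [hds (Fin.castAdd 7 (0 : Fin 5)) (Fin.castAdd 7 s.succ) (Fin.natAdd 5 j'), hFz]
          rw [show (∑ σ, uz σ * d (Fin.natAdd 5 σ) (Fin.natAdd 5 j') (Fin.castAdd 7 s.succ)) =
              ∑ σ, uz σ * d (Fin.natAdd 5 σ) (Fin.castAdd 7 s.succ) (Fin.natAdd 5 j') from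
            sum_congr rfl fun σ _ => by rw [hds], e1]
          ring
      · rw [hzz, hFz]; ring
  -- the radical vector
  let U : Fin (5 + 7) → ZMod 2 := Fin.append (fun i : Fin 5 => if i = 0 then y else 0) uz
  have hsum : ∀ j k, (∑ φ, U φ * d φ j k) = (∑ σ, uz σ * d (Fin.natAdd 5 σ) j k) + y * d (Fin.castAdd 7 (0 : Fin 5)) j k := by
    intro j k
    rw [Fin.sum_univ_add]
    simp only [U, Fin.append_left, Fin.append_right, ite_mul, zero_mul, sum_ite_eq', mem_univ, if_true]
    ring
  have hu := tpr_radical_obstruction c d hpair U (fun j k => by rw [hsum]; exact hcomb j k)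
  apply huz
  funext σ
  have e := congrFun hu (Fin.natAdd 5 σ)
  simp only [U, Fin.append_right, Pi.zero_apply] at e
  exact e

/-- **The radical step of descendant `T` (function level).**  See the module docstring: `κ` cubic with cubic form `d` (`hd`), partner
`c` (`hpair`), `hF`; `d` vanishes on `z_σ × z × z` for `σ ≥ 3`; `û` supported on the free coordinates `3..6`, nonzero; the second
differences of every cell along `(û, e_k)` vanish at `0`; `f_v(û) = f_v(0)` on `Z₁₀`.  Then `False`. [this work] -/
theorem tq1_radical_step (κ : (Fin (5 + 7) → Bool) → Bool) (hκ : IsDegLeFun 3 κ)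
    (c d : Fin (5 + 7) → Fin (5 + 7) → Fin (5 + 7) → ZMod 2)
    (hdc : ∀ φ j k, d j φ k = d φ j k) (hds : ∀ φ j k, d φ k j = d φ j k)
    (hd : ∀ φ j k, d φ j k =
      if ((((κ zeroVec ^^ κ (bxor zeroVec (fun l => decide (l = k)))) ^^
              (κ (bxor zeroVec (fun l => decide (l = j))) ^^ κ (bxor (bxor zeroVec (fun l => decide (l = j))) (fun l => decide (l = k))))) ^^
            ((κ (bxor zeroVec (fun l => decide (l = φ))) ^^ κ (bxor (bxor zeroVec (fun l => decide (l = φ))) (fun l => decide (l = k)))) ^^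
              (κ (bxor (bxor zeroVec (fun l => decide (l = φ))) (fun l => decide (l = j))) ^^
                κ (bxor (bxor (bxor zeroVec (fun l => decide (l = φ))) (fun l => decide (l = j))) (fun l => decide (l = k))))))) = true
      then 1 else 0)
    (hpair : ∀ p φ, (∑ j, ∑ k, (if j < k then c p j k * d φ j k else 0)) = if p = φ then 1 else 0)
    (hF : ∀ j k, d (Fin.castAdd 7 (0 : Fin 5)) j k =
      (if (j = Fin.castAdd 7 (1 : Fin 5) ∧ k = Fin.castAdd 7 (2 : Fin 5)) ∨ (j = Fin.castAdd 7 (2 : Fin 5) ∧ k = Fin.castAdd 7 (1 : Fin 5)) then 1 else 0) +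
      (if (j = Fin.castAdd 7 (3 : Fin 5) ∧ k = Fin.castAdd 7 (4 : Fin 5)) ∨ (j = Fin.castAdd 7 (4 : Fin 5) ∧ k = Fin.castAdd 7 (3 : Fin 5)) then 1 else 0))
    (hzz : ∀ σ : Fin 7, 3 ≤ σ.val → ∀ j k : Fin 7, d (Fin.natAdd 5 σ) (Fin.natAdd 5 j) (Fin.natAdd 5 k) = 0)
    (û : Fin 7 → Bool) (hu0 : û 0 = false) (hu1 : û 1 = false) (hu2 : û 2 = false) (hune : û ≠ zeroVec)
    (h1 : ∀ (v : Fin 4 → Bool) (k : Fin 7),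
      ((κ (Fin.append (Matrix.vecCons false v) zeroVec) ^^ κ (Fin.append (Matrix.vecCons false v) (fun l => decide (l = k)))) ^^
        (κ (Fin.append (Matrix.vecCons false v) û) ^^ κ (Fin.append (Matrix.vecCons false v) (bxor û (fun l => decide (l = k)))))) = false)
    (h2 : ∀ v : Fin 4 → Bool, ((v 0 && v 1) ^^ (v 2 && v 3)) = false →
      κ (Fin.append (Matrix.vecCons false v) û) = κ (Fin.append (Matrix.vecCons false v) zeroVec)) : False := by
  -- the coefficient vector of `û` and the embedded vector `ũ = (0, 0, û)`
  let uz : Fin 7 → ZMod 2 := fun σ => if û σ = true then 1 else 0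
  have huz : uz ≠ 0 := by
    intro h0
    apply hune
    funext σ
    have e := congrFun h0 σ
    simp only [uz, Pi.zero_apply] at e
    cases hσ : û σ
    · rfl
    · rw [hσ] at e; exact absurd e (by simp)
  let Uc : Fin (5 + 7) → ZMod 2 := Fin.append (fun _ : Fin 5 => (0 : ZMod 2)) uz
  let ut : Fin (5 + 7) → Bool := fun i => decide (Uc i = 1)
  have hut : Fin.append (zeroVec : Fin 5 → Bool) û = ut := by
    funext i
    refine Fin.addCases (fun a => ?_) (fun σ => ?_) i
    · simp only [ut, Uc, Fin.append_left]
      show false = _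
      simp
    · simp only [ut, Uc, uz, Fin.append_right]
      cases û σ <;> simp
  -- expansion of third differences along `ut` in the first slot
  have hsum3 : ∀ v w x : Fin (5 + 7) → Bool,
      (if ((((κ x ^^ κ (bxor x w)) ^^ (κ (bxor x v) ^^ κ (bxor (bxor x v) w))) ^^
          ((κ (bxor x ut) ^^ κ (bxor (bxor x ut) w)) ^^ (κ (bxor (bxor x ut) v) ^^ κ (bxor (bxor (bxor x ut) v) w))))) = true
        then (1 : ZMod 2) else 0) =
      ∑ σ : Fin 7, uz σ * (if ((((κ x ^^ κ (bxor x w)) ^^ (κ (bxor x v) ^^ κ (bxor (bxor x v) w))) ^^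
          ((κ (bxor x (fun l => decide (l = Fin.natAdd 5 σ))) ^^ κ (bxor (bxor x (fun l => decide (l = Fin.natAdd 5 σ))) w)) ^^
            (κ (bxor (bxor x (fun l => decide (l = Fin.natAdd 5 σ))) v) ^^ κ (bxor (bxor (bxor x (fun l => decide (l = Fin.natAdd 5 σ))) v) w))))) = true
        then (1 : ZMod 2) else 0) := by
    intro v w x
    have e := tcf_third_sum1 κ hκ Uc v w x
    rw [e, Fin.sum_univ_add]
    simp only [Uc, Fin.append_left, zero_mul, sum_const_zero, zero_add, Fin.append_right]
  -- cells as translates: `κ(0,v,s) = κ(X_v ⊕ (0,0,s))`, `X` additive, `X_0 = 0`, `X_{e_t} = e_{1+t}`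
  have hcell : ∀ (v : Fin 4 → Bool) (s : Fin 7 → Bool), κ (Fin.append (Matrix.vecCons false v) s) =
      κ (bxor (Fin.append (Matrix.vecCons false v) zeroVec) (Fin.append (zeroVec : Fin 5 → Bool) s)) := by
    intro v s; rw [tc5_append_bxor, bxor_zeroVec, zeroVec_bxor]
  have hsplit : ∀ s s' : Fin 7 → Bool, Fin.append (zeroVec : Fin 5 → Bool) (bxor s s') =
      bxor (Fin.append (zeroVec : Fin 5 → Bool) s) (Fin.append (zeroVec : Fin 5 → Bool) s') := by
    intro s s'; rw [tc5_append_bxor, bxor_zeroVec]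
  have hXb : ∀ x t : Fin 4 → Bool, (Fin.append (Matrix.vecCons false (bxor x t)) (zeroVec : Fin 7 → Bool) : Fin (5 + 7) → Bool) =
      bxor (Fin.append (Matrix.vecCons false x) zeroVec) (Fin.append (Matrix.vecCons false t) zeroVec) := by
    intro x t
    rw [tc5_append_bxor, bxor_zeroVec]
    congr 1
    funext l
    refine Fin.cases ?_ (fun i => ?_) l
    · rfl
    · rfl
  have hX0 : (Fin.append (Matrix.vecCons false (zeroVec : Fin 4 → Bool)) (zeroVec : Fin 7 → Bool) : Fin (5 + 7) → Bool) = zeroVec := by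
    funext l
    refine Fin.addCases (fun i => ?_) (fun j => ?_) l
    · rw [Fin.append_left]
      refine Fin.cases rfl (fun i' => rfl) i
    · rw [Fin.append_right]; rfl
  have hXe : ∀ t : Fin 4, (Fin.append (Matrix.vecCons false (fun l => decide (l = t))) (zeroVec : Fin 7 → Bool) : Fin (5 + 7) → Bool) =
      fun l => decide (l = Fin.castAdd 7 t.succ) := by
    intro t
    rw [tc5_unit_left]
    congr 1
    funext l
    refine Fin.cases ?_ (fun i => ?_) l
    · exact (decide_eq_false (fun h => Fin.succ_ne_zero t h.symm)).symm
    · show decide (i = t) = decide (i.succ = t.succ)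
      by_cases h : i = t
      · subst h; simp
      · rw [decide_eq_false h, decide_eq_false (fun h' => h (Fin.succ_inj.mp h'))]
  -- the hypotheses in `κ`-form
  have h1' : ∀ (v : Fin 4 → Bool) (k : Fin 7),
      ((κ (Fin.append (Matrix.vecCons false v) zeroVec) ^^ κ (bxor (Fin.append (Matrix.vecCons false v) zeroVec) (fun l => decide (l = Fin.natAdd 5 k)))) ^^
        (κ (bxor (Fin.append (Matrix.vecCons false v) zeroVec) ut) ^^
          κ (bxor (bxor (Fin.append (Matrix.vecCons false v) zeroVec) ut) (fun l => decide (l = Fin.natAdd 5 k))))) = false := by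
    intro v k
    have e := h1 v k
    rw [hcell v (fun l => decide (l = k)), hcell v û, hcell v (bxor û _), hsplit, ← tc5_unit_right, hut, ← iw_bxor_assoc] at e
    exact e
  have h2' : ∀ v : Fin 4 → Bool, ((v 0 && v 1) ^^ (v 2 && v 3)) = false →
      κ (bxor (Fin.append (Matrix.vecCons false v) zeroVec) ut) = κ (Fin.append (Matrix.vecCons false v) zeroVec) := by
    intro v hv
    have e := h2 v hv
    rw [hcell v û, hut] at e
    exact e
  -- (1) `Σ u_σ d(z_σ, z_j, z_k) = 0`
  have hfree : ∀ σ : Fin 7, û σ = true → 3 ≤ σ.val := by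
    intro σ hσ
    by_contra hlt
    have hv : σ.val = 0 ∨ σ.val = 1 ∨ σ.val = 2 := by omega
    rcases hv with h | h | h
    · rw [show σ = 0 from Fin.ext h, hu0] at hσ; exact Bool.false_ne_true hσ
    · rw [show σ = 1 from Fin.ext h, hu1] at hσ; exact Bool.false_ne_true hσ
    · rw [show σ = 2 from Fin.ext h, hu2] at hσ; exact Bool.false_ne_true hσ
  have hzz' : ∀ j k : Fin 7, (∑ σ, uz σ * d (Fin.natAdd 5 σ) (Fin.natAdd 5 j) (Fin.natAdd 5 k)) = 0 := by
    intro j k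
    refine sum_eq_zero fun σ _ => ?_
    by_cases hσ : û σ = true
    · rw [hzz σ (hfree σ hσ), mul_zero]
    · simp [uz, hσ]
  -- (2) `Σ u_σ d(z_σ, v_t, z_k) = 0`: the third difference along `(e_{v_t}, ut, e_{z_k})` is `Δ_{ut,z_k}(0) ⊕ Δ_{ut,z_k}(e_{v_t}) = 0 ⊕ 0`
  have hvz' : ∀ (t : Fin 4) (k : Fin 7), (∑ σ, uz σ * d (Fin.natAdd 5 σ) (Fin.castAdd 7 t.succ) (Fin.natAdd 5 k)) = 0 := by
    intro t k
    have hT : ((((κ zeroVec ^^ κ (bxor zeroVec (fun l => decide (l = Fin.natAdd 5 k)))) ^^ (κ (bxor zeroVec ut) ^^ κ (bxor (bxor zeroVec ut) (fun l => decide (l = Fin.natAdd 5 k))))) ^^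
        ((κ (bxor zeroVec (fun l => decide (l = Fin.castAdd 7 t.succ))) ^^ κ (bxor (bxor zeroVec (fun l => decide (l = Fin.castAdd 7 t.succ))) (fun l => decide (l = Fin.natAdd 5 k)))) ^^ (κ (bxor (bxor zeroVec (fun l => decide (l = Fin.castAdd 7 t.succ))) ut) ^^ κ (bxor (bxor (bxor zeroVec (fun l => decide (l = Fin.castAdd 7 t.succ))) ut) (fun l => decide (l = Fin.natAdd 5 k))))))) = false := by
      have a := h1' zeroVec k
      have b := h1' (fun l => decide (l = t)) k
      rw [hX0] at a
      rw [hXe] at b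
      simp only [zeroVec_bxor] at a b ⊢
      rw [a, b]
      decide
    conv_lhs => arg 2; ext σ; rw [hd]
    rw [← hsum3 (fun l => decide (l = Fin.castAdd 7 t.succ)) (fun l => decide (l = Fin.natAdd 5 k)) zeroVec,
      tcf_third_swap12 κ ut (fun l => decide (l = Fin.castAdd 7 t.succ)) (fun l => decide (l = Fin.natAdd 5 k)) zeroVec, hT]
    simp
  -- (3) the first difference `q(v) = f_v(û) ⊕ f_v(0)`: vanishes on `Z₁₀`, constant second differences
  have hB : ∀ s t x : Fin 4 → Bool,
      (((κ (Fin.append (Matrix.vecCons false x) zeroVec) ^^ κ (bxor (Fin.append (Matrix.vecCons false x) zeroVec) ut)) ^^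
          ((κ (Fin.append (Matrix.vecCons false (bxor x t)) zeroVec) ^^ κ (bxor (Fin.append (Matrix.vecCons false (bxor x t)) zeroVec) ut)))) ^^
        (((κ (Fin.append (Matrix.vecCons false (bxor x s)) zeroVec) ^^ κ (bxor (Fin.append (Matrix.vecCons false (bxor x s)) zeroVec) ut))) ^^
          ((κ (Fin.append (Matrix.vecCons false (bxor (bxor x s) t)) zeroVec) ^^
            κ (bxor (Fin.append (Matrix.vecCons false (bxor (bxor x s) t)) zeroVec) ut))))) =
      (((κ zeroVec ^^ κ (bxor zeroVec ut)) ^^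
          (κ (bxor zeroVec (Fin.append (Matrix.vecCons false t) zeroVec)) ^^ κ (bxor (bxor zeroVec (Fin.append (Matrix.vecCons false t) zeroVec)) ut))) ^^
        ((κ (bxor zeroVec (Fin.append (Matrix.vecCons false s) zeroVec)) ^^ κ (bxor (bxor zeroVec (Fin.append (Matrix.vecCons false s) zeroVec)) ut)) ^^
          (κ (bxor (bxor zeroVec (Fin.append (Matrix.vecCons false s) zeroVec)) (Fin.append (Matrix.vecCons false t) zeroVec)) ^^
            κ (bxor (bxor (bxor zeroVec (Fin.append (Matrix.vecCons false s) zeroVec)) (Fin.append (Matrix.vecCons false t) zeroVec)) ut)))) := by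
    intro s t x
    simp only [hXb]
    exact tcf_third_const κ hκ _ _ _ _ _
  have hz : ∀ v : Fin 4 → Bool, ((v 0 && v 1) ^^ (v 2 && v 3)) = false →
      (κ (Fin.append (Matrix.vecCons false v) zeroVec) ^^ κ (bxor (Fin.append (Matrix.vecCons false v) zeroVec) ut)) = false := by
    intro v hv
    rw [h2' v hv]
    exact Bool.xor_self _
  have P := tq4_polar_table (fun v => κ (Fin.append (Matrix.vecCons false v) zeroVec) ^^ κ (bxor (Fin.append (Matrix.vecCons false v) zeroVec) ut))
    (fun s t => (((κ zeroVec ^^ κ (bxor zeroVec ut)) ^^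
          (κ (bxor zeroVec (Fin.append (Matrix.vecCons false t) zeroVec)) ^^ κ (bxor (bxor zeroVec (Fin.append (Matrix.vecCons false t) zeroVec)) ut))) ^^
        ((κ (bxor zeroVec (Fin.append (Matrix.vecCons false s) zeroVec)) ^^ κ (bxor (bxor zeroVec (Fin.append (Matrix.vecCons false s) zeroVec)) ut)) ^^
          (κ (bxor (bxor zeroVec (Fin.append (Matrix.vecCons false s) zeroVec)) (Fin.append (Matrix.vecCons false t) zeroVec)) ^^
            κ (bxor (bxor (bxor zeroVec (Fin.append (Matrix.vecCons false s) zeroVec)) (Fin.append (Matrix.vecCons false t) zeroVec)) ut)))))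
    hB hz
  -- the table `[B(e_a, e_c)] = Σ u_σ d(z_σ, v_a, v_c)`
  have hBac : ∀ a b : Fin 4,
      (if ((((κ zeroVec ^^ κ (bxor zeroVec ut)) ^^ (κ (bxor zeroVec (Fin.append (Matrix.vecCons false (fun l => decide (l = b))) zeroVec)) ^^ κ (bxor (bxor zeroVec (Fin.append (Matrix.vecCons false (fun l => decide (l = b))) zeroVec)) ut))) ^^
        ((κ (bxor zeroVec (Fin.append (Matrix.vecCons false (fun l => decide (l = a))) zeroVec)) ^^ κ (bxor (bxor zeroVec (Fin.append (Matrix.vecCons false (fun l => decide (l = a))) zeroVec)) ut)) ^^ (κ (bxor (bxor zeroVec (Fin.append (Matrix.vecCons false (fun l => decide (l = a))) zeroVec)) (Fin.append (Matrix.vecCons false (fun l => decide (l = b))) zeroVec)) ^^ κ (bxor (bxor (bxor zeroVec (Fin.append (Matrix.vecCons false (fun l => decide (l = a))) zeroVec)) (Fin.append (Matrix.vecCons false (fun l => decide (l = b))) zeroVec)) ut))))) = true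
        then (1 : ZMod 2) else 0) =
      ∑ σ, uz σ * d (Fin.natAdd 5 σ) (Fin.castAdd 7 a.succ) (Fin.castAdd 7 b.succ) := by
    intro a b
    rw [hXe, hXe, tcf_third_swap23 κ (fun l => decide (l = Fin.castAdd 7 a.succ)) (fun l => decide (l = Fin.castAdd 7 b.succ)) ut zeroVec,
      tcf_third_swap12 κ (fun l => decide (l = Fin.castAdd 7 a.succ)) ut (fun l => decide (l = Fin.castAdd 7 b.succ)) zeroVec,
      hsum3 (fun l => decide (l = Fin.castAdd 7 a.succ)) (fun l => decide (l = Fin.castAdd 7 b.succ)) zeroVec]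
    refine sum_congr rfl fun σ _ => ?_
    rw [hd]
  -- `d(y_a, v_a, v_c)` from `hF`
  have hFab : ∀ a b : Fin 4, d (Fin.castAdd 7 (0 : Fin 5)) (Fin.castAdd 7 a.succ) (Fin.castAdd 7 b.succ) =
      (if (a = 0 ∧ b = 1) ∨ (a = 1 ∧ b = 0) then (1 : ZMod 2) else 0) + (if (a = 2 ∧ b = 3) ∨ (a = 3 ∧ b = 2) then (1 : ZMod 2) else 0) := by
    intro a b
    rw [hF, show (1 : Fin 5) = Fin.succ (0 : Fin 4) from rfl, show (2 : Fin 5) = Fin.succ (1 : Fin 4) from rfl,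
      show (3 : Fin 5) = Fin.succ (2 : Fin 4) from rfl, show (4 : Fin 5) = Fin.succ (3 : Fin 4) from rfl]
    simp only [Fin.castAdd_inj, Fin.succ_inj]
  -- conclude with the form-level lemma
  refine tq1_radical c d hdc hds hpair hF uz (∑ σ, uz σ * d (Fin.natAdd 5 σ) (Fin.castAdd 7 (0 : Fin 4).succ) (Fin.castAdd 7 (1 : Fin 4).succ))
    huz hzz' hvz' (fun a b => ?_)
  have e := P a b
  rw [hBac, hBac, ← hFab] at e
  exact e

end Summit.QuantumAdvantage.QuantumAdvantage.Theorems.CubicForrelation.NearExactIsExact
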